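import Summits.AtomisticToContinuum.Crystallization.Theorems.FrustratedLawDichotomyCollarCensusGeneric

/-!
# FrustratedLawDichotomy · crux `PeriodicFrustratedLawGap` (stmt-AtomisticToContinuum-27624, sibling of 27623) — the collared leaf line for the
# PERIODIC sibling, generic in the range data and at the levies of record (decomp-a2c, prover hand 2, generation 17)

The route's two cruxes share every door (`…ExemptSplit.aperiodicFrustratedLawGap_of_splitX` / `periodicFrustratedLawGap_of_splitX`).  The collared
census column was typed for the aperiodic crux only beyond `…CollarCensus.periodicFrustratedLawGap_of_collarMotifCap` (levy `1/100`, now refuted: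
`…CellTEQ15Kill.not_collarPieces_record`).  This file gives the sibling the same leaf line BY NAME:
* §1 ★ `periodicFrustratedLawGap_of_collarMotifCapKK_generic` / `…_of_collarPiecesKK_generic` — generic range data `(w, ω, A, R, B, R′ ≤ 23/2, eUp)`,
  both levies `0 < κ_T ≤ 1`, `0 < κ_E`, record geometry literals;
* §2 ★★ `periodicFrustratedLawGap_of_collarPiecesKK_milli` — the record range data (`W₄₅`, `SF₄₅` by `sf₄₅_holds`, `UP(−0.7175)`) at the levies of
  record `κ_T = 1/1000`, `κ_E = 1/10000`: `MuEquilibriumDoor ∧ UP ∧ Eopt-raw(1/10000) ∧ F1^X♯(1/1000) ∧ CC♯(1/1000) ∧ DD♯(1/1000) ⟹ PeriodicFrustratedLawGap`.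
All `[folklore]` chaining; 0 sorry; no definitions.
-/

noncomputable section

namespace Summit.AtomisticToContinuum.Crystallization.Theorems.FrustratedLawDichotomyCollarCensusPeriodic

open scoped BigOperators Classical
open Summit.AtomisticToContinuum.Crystallization.Theorems.ChargedEnergyGapNegative (E3 eStar)
open Summit.AtomisticToContinuum.Crystallization.Theorems.FrustratedLawDichotomyRangeCut
open Summit.AtomisticToContinuum.Crystallization.Theorems.FrustratedLawDichotomySchurCut
open Summit.AtomisticToContinuum.Crystallization.Theorems.FrustratedLawDichotomyAveragingCut
  (Mball one_le_Mball Dfl Dfl_pos CT₀ Dfl_le_CT₀ CT₄₅ W₄₅_cutBounds CutBounds)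
open Summit.AtomisticToContinuum.Crystallization.Theorems.FrustratedLawDichotomyAveragingRule
open Summit.AtomisticToContinuum.Crystallization.Theorems.FrustratedLawDichotomyAveragingRuleCap
open Summit.AtomisticToContinuum.Crystallization.Theorems.FrustratedLawDichotomyExemptDoor (SitePred)
open Summit.AtomisticToContinuum.Crystallization.Theorems.FrustratedLawDichotomyExemptLocOpt (LocOptFails deepAbsent_locOptFails)
open Summit.AtomisticToContinuum.Crystallization.Theorems.FrustratedLawDichotomyExemptSplit
  (SchurTopologicalPricingX SchurElasticPricingX periodicFrustratedLawGap_of_splitX)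
open Summit.AtomisticToContinuum.Crystallization.Theorems.FrustratedLawDichotomyExemptAbsorption
open Summit.AtomisticToContinuum.Crystallization.Theorems.FrustratedLawDichotomyExemptAbsorptionRecord
open Summit.AtomisticToContinuum.Crystallization.Theorems.FrustratedLawDichotomyCollarCensus
open Summit.AtomisticToContinuum.Crystallization.Theorems.FrustratedLawDichotomyCollarCensusKappa

/-! ## §1. The periodic sibling, generic range data -/

/-- ★ **THE COLLARED NODE FOR THE PERIODIC SIBLING, GENERIC IN THE RANGE DATA AND BOTH LEVIES** (census-object form; hypotheses as in
`…CollarCensusGeneric.aperiodicFrustratedLawGap_of_collarMotifCapKK_generic`). [folklore chaining] -/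
theorem periodicFrustratedLawGap_of_collarMotifCapKK_generic {w ω : ℝ → ℝ} {A R B R' eUp κT κE ρ r ρ₁ ϱ D ε Rm s t ϱ' CE DE DX : ℝ}
    (hDoor : Summit.AtomisticToContinuum.Crystallization.Theses.GrainCoreNetworkSplit.MuEquilibriumDoor)
    (hF : SchurFloor w ω A) (hWB : CutBounds (effPot w ω A) R B) (hW : ∀ u, R' ≤ u → effPot w ω A u = 0)
    (hU : PeriodicEnergyCeiling eUp) (hε : 0 < ε) (hDX : 0 ≤ DX) (hκE : 0 < κE)
    (hE : SchurElasticPricingX (1 / 20) (1 / 8) w ω A eUp κE CE DE DX (LocOptFails eStar ε ϱ' 1))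
    (hκ0 : 0 < κT) (hκ1 : κT ≤ 1) (h0 : 0 ≤ ρ) (hr : 0 ≤ r) (h1 : 0 ≤ ρ₁) (hρ : ρ ≤ ρ₁ + r) (hR : R' ≤ ρ₁ + r)
    (hD : 13 / 10 * D + 1 ≤ ρ₁ + r) (hRm : Rm ≤ ρ₁) (hϱ : ρ + (ρ₁ + r) ≤ ϱ) (hRm1 : 1 + s ≤ Rm) (hs0 : 0 ≤ s) (hs : s ≤ ϱ') (hεt : ε ≤ t)
    (h : EquilibriumMotifPricingCapK κT ρ ϱ D (effPot w ω A) (eUp + A) (CollarCore r eUp ε Rm s t)) :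
    Summit.AtomisticToContinuum.Crystallization.Theses.FrustratedLawDichotomy.PeriodicFrustratedLawGap := by
  have hC : 0 ≤ CT₀ R B (eUp + A) ρ :=
    (Dfl_pos hWB.range_nonneg hWB.floor_nonneg).le.trans (Dfl_le_CT₀ hWB.range_nonneg hWB.floor_nonneg ρ)
  have hM : 0 ≤ Mball r * CT₀ R B (eUp + A) ρ := mul_nonneg (zero_le_one.trans (one_le_Mball hr)) hC
  have hUp : eStar ≤ eUp := eStar_le_of_periodicEnergyCeiling hU
  have hT : SchurTopologicalPricingX (1 / 20) (1 / 8) w ω A eUp κT (CT₀ R B (eUp + A) ρ) (Mball r * CT₀ R B (eUp + A) ρ)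
      (LocOptFails eStar ε ϱ' 1) := by
    unfold CollarCore at h
    exact schurTopologicalPricingX_of_collarMotifCapK hWB hW h0 hr h1 hρ hR hD hϱ (flag_nonEquilibriumCore_isLocal hRm) hκ0.le hκ1
      (fun _ _ _ hsep _ hx => locOptFails_of_nonEquilibriumCore hUp hRm1 hs0 hs hεt hsep hx) h
  exact periodicFrustratedLawGap_of_splitX hDoor (by norm_num) hF hU (deepAbsent_locOptFails hε) hκ0 hM hT hκE hDX hE

/-- ★ **THE PERIODIC SIBLING IN THREE PIECES, GENERIC RANGE DATA, RECORD GEOMETRY** (`R′ ≤ 23/2`). [folklore chaining] -/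
theorem periodicFrustratedLawGap_of_collarPiecesKK_generic {w ω : ℝ → ℝ} {A R B R' eUp κT κE CE DE DX : ℝ}
    (hDoor : Summit.AtomisticToContinuum.Crystallization.Theses.GrainCoreNetworkSplit.MuEquilibriumDoor)
    (hF : SchurFloor w ω A) (hWB : CutBounds (effPot w ω A) R B) (hW : ∀ u, R' ≤ u → effPot w ω A u = 0) (hR' : R' ≤ 23 / 2)
    (hU : PeriodicEnergyCeiling eUp) (hDX : 0 ≤ DX) (hκE : 0 < κE)
    (hE : SchurElasticPricingX (1 / 20) (1 / 8) w ω A eUp κE CE DE DX (LocOptFails eStar (1 / 10000) (3 / 2) 1))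
    (hκ0 : 0 < κT) (hκ1 : κT ≤ 1)
    (h1 : StrainedPatchMotifPricingCapXK κT (9 / 5) (133 / 10) (3 / 2) (effPot w ω A) (eUp + A)
      (CollarCore (9 / 2) eUp (1 / 10000) 7 (1 / 20) (1 / 10000)))
    (h2 : CrowdedCoreMotifPricingCapK κT (9 / 5) (133 / 10) (3 / 2) (effPot w ω A) (eUp + A)
      (CollarCore (9 / 2) eUp (1 / 10000) 7 (1 / 20) (1 / 10000)))
    (h3 : DiluteDefectMotifPricingCapK κT (9 / 5) (133 / 10) (3 / 2) (effPot w ω A) (eUp + A)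
      (CollarCore (9 / 2) eUp (1 / 10000) 7 (1 / 20) (1 / 10000))) :
    Summit.AtomisticToContinuum.Crystallization.Theses.FrustratedLawDichotomy.PeriodicFrustratedLawGap :=
  periodicFrustratedLawGap_of_collarMotifCapKK_generic (ρ₁ := 7) hDoor hF hWB hW hU (by norm_num) hDX hκE hE hκ0 hκ1 (by norm_num) (by norm_num)
    (by norm_num) (by norm_num) (by linarith) (by norm_num) le_rfl (by norm_num) (by norm_num) (by norm_num) (by norm_num) le_rfl
    (equilibriumMotifPricingCapK_iff_pieces.2 ⟨h1, h2, h3⟩)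

/-! ## §2. The periodic sibling at the record range data and the levies of record -/

/-- ★★ **THE PERIODIC SIBLING'S LEAF LINE AT THE LEVIES OF RECORD** `κ_T = 1/1000`, `κ_E = 1/10000` (record range data `W₄₅`, `SF₄₅`, `UP(−0.7175)`
as hypothesis `hU`): `MuEquilibriumDoor ∧ UP ∧ Eopt-raw(1/10000) ∧ F1^X♯(1/1000) ∧ CC♯(1/1000) ∧ DD♯(1/1000) ⟹ PeriodicFrustratedLawGap`.
[folklore instantiation] -/
theorem periodicFrustratedLawGap_of_collarPiecesKK_milli {CE DE DX : ℝ}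
    (hDoor : Summit.AtomisticToContinuum.Crystallization.Theses.GrainCoreNetworkSplit.MuEquilibriumDoor)
    (hU : PeriodicEnergyCeiling (-(7175 / 10000))) (hDX : 0 ≤ DX)
    (hE : SchurElasticPricingX (1 / 20) (1 / 8) w₄₅ ω₄ (3 / 400) (-(7175 / 10000)) (1 / 10000) CE DE DX
      (LocOptFails eStar (1 / 10000) (3 / 2) 1))
    (h1 : StrainedPatchMotifPricingCapXK (1 / 1000) (9 / 5) (133 / 10) (3 / 2) (effPot w₄₅ ω₄ (3 / 400)) (-(7175 / 10000) + 3 / 400)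
      (CollarCore (9 / 2) (-(7175 / 10000)) (1 / 10000) 7 (1 / 20) (1 / 10000)))
    (h2 : CrowdedCoreMotifPricingCapK (1 / 1000) (9 / 5) (133 / 10) (3 / 2) (effPot w₄₅ ω₄ (3 / 400)) (-(7175 / 10000) + 3 / 400)
      (CollarCore (9 / 2) (-(7175 / 10000)) (1 / 10000) 7 (1 / 20) (1 / 10000)))
    (h3 : DiluteDefectMotifPricingCapK (1 / 1000) (9 / 5) (133 / 10) (3 / 2) (effPot w₄₅ ω₄ (3 / 400)) (-(7175 / 10000) + 3 / 400)
      (CollarCore (9 / 2) (-(7175 / 10000)) (1 / 10000) 7 (1 / 20) (1 / 10000))) :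
    Summit.AtomisticToContinuum.Crystallization.Theses.FrustratedLawDichotomy.PeriodicFrustratedLawGap :=
  periodicFrustratedLawGap_of_collarPiecesKK_generic hDoor
    Summit.AtomisticToContinuum.Crystallization.Theorems.FrustratedLawDichotomyBumpAutocorrelation.sf₄₅_holds W₄₅_cutBounds
    (fun _ hu => effPot_fourHalf_eq_zero _ hu) (by norm_num) hU hDX (by norm_num) hE (by norm_num) (by norm_num) h1 h2 h3

end Summit.AtomisticToContinuum.Crystallization.Theorems.FrustratedLawDichotomyCollarCensusPeriodic

end
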